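import Summits.BirchSwinnertonDyer.BirchSwinnertonDyer.Theorems.ByReductionTypeAtTwoTowerRelChi
import Summits.BirchSwinnertonDyer.BirchSwinnertonDyer.Theorems.ByReductionTypeAtTwoMultIrredClass311542bt
import Summits.BirchSwinnertonDyer.BirchSwinnertonDyer.Theorems.ByReductionTypeAtTwoMultIrredClass311542r
import Summits.BirchSwinnertonDyer.BirchSwinnertonDyer.Theorems.ByReductionTypeAtTwoMultIrredClass317322p
import Summits.BirchSwinnertonDyer.BirchSwinnertonDyer.Theorems.ByReductionTypeAtTwoMultIrredClass334050bm
import Summits.BirchSwinnertonDyer.BirchSwinnertonDyer.Theorems.ByReductionTypeAtTwoMultIrredClass368186bc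
import Summits.BirchSwinnertonDyer.BirchSwinnertonDyer.Theorems.ByReductionTypeAtTwoMultIrredClass381938m
import Summits.BirchSwinnertonDyer.BirchSwinnertonDyer.Theorems.ByReductionTypeAtTwoMultKatoNonsplitDescent
import Summits.BirchSwinnertonDyer.BirchSwinnertonDyer.Theorems.ByReductionTypeAtTwoMultKatoSplitDescent
import HarnessLib

/-!
# «REL-χ ALT» MODULE `RelChiAlt05` (multiplicative `2`, `E[2]` irreducible) — tower gaps from the EXPONENT certificate of `A_n[2]` + displays for 6 classes
# whose kernel-decided data ALREADY live in a tree class file of another road (route ByReductionTypeAtTwo, item `MultUpperHalfAtTwo`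
# stmt-BirchSwinnertonDyer-19922; seat bsd-2adic-tower-1 GEN 17; generator `tower/gen17/relchi_alt.py`)

Cell `bsd-2adic` (run/shared/lean/pub/bsd-2adic/). Members: `311542bt1`, `311542r1`, `317322p1`, `334050bm1`, `368186bc1`, `381938m1`. For each member `<lab>` (an `E[2]`-irreducible multiplicative-at-`2` X5 class of the
A-currency residue's LAYER-4 customers — no layer-3 window certifies, tower/NOTE-ACUR-RESIDUE-GEN16.md) this module IMPORTS the existing class file (no
duplicate kernel data) and adds, in namespace `MultTowerRelChiClass`:
* `towerGapAtTwo_<lab>_RX` — `TowerGapAtTwo c<lab>` from the numeral-free EXPONENT certificate «`b < 2ⁿ` and `(conj_γ − id)^[b] z = 0` for every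
  `2`-torsion class `z` of `A_n = h_n⁻¹(Sel_{2^∞}(E/ℚ_∞))`, every cyclotomic `κ`, every topological generator `γ`» (door
  `TowerRelChi.towerGapAtTwo_of_exponent_classes_of_irr` ⟵ GEN 13's `TowerFiltration.towerGapAtTwo_of_exponent_classes`);
* `missingUpperBoundAt_two_<lab>_RX` — the item's upper half AT the curve (universal MEMO keying `hKato`/`hGS`, as the A-currency doors of record);
* `bsdp_two_<lab>_RX_of_descent` — the desk display BORN DESCENT-KEYED (RC-188 (2)(b) keying: located {`hne`, `h12`, `hdesc` | `hdescS` + `hGS₁`, `h15`}).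
CERTIFICATE OF RECORD for `hkill` (`n = 4`, `b = 15`), per member in its section header: the «REL-χ TOP» test at LAYER 3 (tower/NOTE-RELCHI-GEN17.md §4;
kits j296470; ENGINE `tower/gen17/engine/sel2relchi.gp` @b474f5a19f1a2c12 = ENGINE A3σ `tower/gen13/sel2sigma_a3.gp` @952348f3be3114e0 + the [RELCHI] block): on the UPPER
induced basis `S^hi ⊇ A_3[2]` of the layer-3 descent the engine computes the σ-matrix (SIGMA block; referee C R994) and the Hilbert symbols `(2 + y_3, ·)_𝔓` at the
primes of `L_3 = ℚ_3[x]/(f)` of local degree 1 over the places of `ℚ_3` not split in `ℚ_4`; the symbol functionals SEPARATE the top `(σ−1)`-layer of `S^hi`, so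
`cor_{ℚ_4/ℚ_3}(A_4[2]) ⊆ S^hi ∩ ker Φ ⊆ S^hi[ν^7]` (inflation–restriction with `E(ℚ_4)[2] = 0`; `cor H¹(ℚ_4, E[2]) ⊆ ker(∪χ)`; local Tate duality in the
Hilbert-symbol form) and `(σ'−1)^15 A_4[2] = (σ−1)^7 res(cor A_4[2]) = 0`. This is an INFERRED exponent — NO layer-4 descent was run (the degree-48 descent is
infeasible: ord-2 GEN 8, mult-2 GEN 12); premises = the A-currency engine premises of record (R986) + textbook Galois cohomology (NOTE §5); ONE engine so far —
a method-disjoint second engine of the symbol block is WANTED (RC-182) before any row; the referees decide the tier of an inferred exponent.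
HONEST FRAMING (HUMAN RULINGS D-0036 / D-0054 / D-0074): class-display theorems only — no definition, no new named fact, no `sorry`; no class closes here,
nothing is booked; BSD is not proved by any of this.
References: [GreenbergLNM1716] §1 p. 60, §2 pp. 74–76, §3 pp. 85–94, §4 pp. 112–113; [Kato2004Asterisque] Thm. 12.4, 17.4; [Cesnavicius2018] Thm. 1.2;
[Miller2011LMS] Def. 1.1; [Washington1997] §13.2.
-/

set_option autoImplicit false
-- the Theorems namespace of this sub repeats the summit name by design (D-0017 nested layout: Summit.<S>.<Sub>)
set_option linter.dupNamespace false

noncomputable section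

open scoped Classical MatrixGroups ModularForm

open NumberField IsDedekindDomain CongruenceSubgroup WeierstrassCurve Literature.NumberTheory.EllipticCurves
  Literature.NumberTheory.EllipticCurves.ModularForms Literature.NumberTheory.EllipticCurves.Rank1Residual
  Literature.NumberTheory.EllipticCurves.Rank1Residual.Typed
  Literature.NumberTheory.EllipticCurves.Rank1Residual.X11RankOneCertificates
  Literature.NumberTheory.EllipticCurves.Greenberg1999
  Summit.BirchSwinnertonDyer.Rank1Residual.X5 Summit.BirchSwinnertonDyer.Rank1Residual.X5.O1
  Summit.BirchSwinnertonDyer.Rank1Residual.X5.Instances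
  Summit.BirchSwinnertonDyer.BirchSwinnertonDyer.Theorems.KatoHalfPinch
  Summit.BirchSwinnertonDyer.BirchSwinnertonDyer.Theorems.Rank1ResidualX1Defs

namespace Summit.BirchSwinnertonDyer.BirchSwinnertonDyer.Theorems.MultTowerRelChiClass

/-! ### `311542bt1` (class `311542bt`, `N = 311542`, NON-SPLIT at `2`; kernel data: `MultIrredClass.c311542bt1` of `ByReductionTypeAtTwoMultIrredClass311542bt`)
CERTIFICATE OF RECORD (REL-χ TOP, tower/NOTE-RELCHI-GEN17.md §4; kit j296470, ENGINE `tower/gen17/engine/sel2relchi.gp` @b474f5a19f1a2c12, layer 3): upper induced basis `ehi₃ = 10` (σ-vector `3,4,5,6,7,8,9,10`, `dim S^hi[ν^7] = 9`), symbol functionals `ncert = 14` (places ['11w1', '17w1', '17w2', '17w3', '17w4', '2', '7w1', '7w2']), ranks `r(S^hi) = 8`, `r(S^hi[ν^7]) = 7` ⇒ `r − r_H = 1 = dim S^hi − dim S^hi[ν^7]` ⇒ `(σ'−1)^15` kills `A_4[2]` (`n = 4`, `b = 15`). Plain bound `a_4 ≤ 2·ehi₃ − r = 12`. ONE engine so far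 (RC-182: second engine wanted). -/

/-- **Tower gap for `311542bt1` from the EXPONENT certificate** «`(conj_γ − id)^[b]` kills `A_n[2]`, `b < 2ⁿ`» (numeral-free; of record `n = 4`, `b = 15`, REL-χ TOP at layer 3 —
an INFERRED exponent, no layer-4 descent was run). [cite: GreenbergLNM1716, §1 p. 60 and §3 pp. 85–86] [cite: Washington1997, §13.2] -/
theorem towerGapAtTwo_311542bt1_RX
    {n b : ℕ} (hb : b < 2 ^ n)
    (hkill : ∀ (κ : ZpExtension ℚ 2) (γ : Field.absoluteGaloisGroup ℚ), κ.IsCyclotomic → κ.IsTopGenerator γ →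
      ∀ z : MultIrredClass.c311542bt1.selmerInftyPreimage κ n, 2 • z = 0 →
        (⇑(MultIrredClass.c311542bt1.conjH1 2 (κ.layerSubgroup n) γ - AddMonoidHom.id (MultIrredClass.c311542bt1.subgroupH1 2 (κ.layerSubgroup n))))^[b] (z : MultIrredClass.c311542bt1.subgroupH1 2 (κ.layerSubgroup n)) = 0) : TowerGapAtTwo MultIrredClass.c311542bt1 :=
  TowerRelChi.towerGapAtTwo_of_exponent_classes_of_irr MultIrredClass.c311542bt1 MultIrredClass.irr_two_311542bt1 hb hkill

/-- **UPPER HALF `MissingUpperBoundAt 311542bt1 2`** (item 19922 AT this curve; Cassels ⇒ its class) from the EXPONENT certificate: PRINT {h41ns', h41sp, hmod, hGZK, hCassels, hC}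
+ MEMO {hKato (RC-2), hGS (RC-4)} + CERT {hr, hb, hkill}. [cite: GreenbergLNM1716, §3 pp. 85–94 and §4 pp. 112–113] [cite: Cesnavicius2018, Thm. 1.2] [cite: Miller2011LMS, Def. 1.1] -/
theorem missingUpperBoundAt_two_311542bt1_RX
    (hKato : ∀ (W : WeierstrassCurve ℚ) [W.IsElliptic] [W.IsGloballyMinimal],
      ¬ W.HasCM → Mult W 2 → O1.KatoMultiplicativeDivisibilityRat W 2)
    (h41ns' : thm41Analogue_charValue_rankZero_numberField_anyPrime_oddLocalDegree)
    (h41sp : thm41Analogue_charValue_rankZero_split_baseChange_anyPrime)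
    (hmod : nonempty_modularParametrizationData) (hGZK : rank_eq_analyticRank_of_analyticRank_le_one)
    (hCassels : bsdRHS_eq_of_isIsogenous) (hC : cesnavicius_not_two_dvd_maninConstant_of_two_dvd_level)
    (hGS : ∀ (W : WeierstrassCurve ℚ) [W.IsElliptic] [W.IsGloballyMinimal],
      W.HasSplitMultiplicativeReductionAtPrime 2 → greenberg_stevens (W := W) (p := 2))
    (hr : MultIrredClass.c311542bt1.analyticRank = 0)
    {n b : ℕ} (hb : b < 2 ^ n)
    (hkill : ∀ (κ : ZpExtension ℚ 2) (γ : Field.absoluteGaloisGroup ℚ), κ.IsCyclotomic → κ.IsTopGenerator γ →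
      ∀ z : MultIrredClass.c311542bt1.selmerInftyPreimage κ n, 2 • z = 0 →
        (⇑(MultIrredClass.c311542bt1.conjH1 2 (κ.layerSubgroup n) γ - AddMonoidHom.id (MultIrredClass.c311542bt1.subgroupH1 2 (κ.layerSubgroup n))))^[b] (z : MultIrredClass.c311542bt1.subgroupH1 2 (κ.layerSubgroup n)) = 0) : MissingUpperBoundAt MultIrredClass.c311542bt1 2 :=
  TowerRelChi.missingUpperBoundAt_two_of_exponent_classes MultIrredClass.c311542bt1 hKato h41ns' h41sp hmod hGZK hCassels hC hGS hr
    MultIrredClass.mult_two_311542bt1 MultIrredClass.irr_two_311542bt1 hb hkill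

/-- **DESK DISPLAY `BSD(311542bt1, 2)`, BORN DESCENT-KEYED** (NON-SPLIT at `2`): located inputs {`hne`, `h12`, `hdesc`, `h15`},
gap = `towerGapAtTwo_311542bt1_RX`; display = PRINT {h41ns', h41sp, hmod, hGZK, hCassels, hC} + `hdesc` + `hr` + CERT {hb, hkill} + `hsha`.
Not a booking. [cite: Kato2004Asterisque, Thm. 17.4] [cite: Miller2011LMS, Def. 1.1] -/
theorem bsdp_two_311542bt1_RX_of_descent
    (hne : Kato2004.nonempty_iwasawaH1Data) (h12 : Kato2004.thm12_4)
    (hdesc : Kato2004.exists_multDivisibilityInputsDescent_nonsplit)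
    (h15 : thm15_isTorsion_multiplicative_rat)
    (h41ns' : thm41Analogue_charValue_rankZero_numberField_anyPrime_oddLocalDegree)
    (h41sp : thm41Analogue_charValue_rankZero_split_baseChange_anyPrime)
    (hmod : nonempty_modularParametrizationData) (hGZK : rank_eq_analyticRank_of_analyticRank_le_one)
    (hCassels : bsdRHS_eq_of_isIsogenous) (hC : cesnavicius_not_two_dvd_maninConstant_of_two_dvd_level)
    (hr : MultIrredClass.c311542bt1.analyticRank = 0)
    {n b : ℕ} (hb : b < 2 ^ n)
    (hkill : ∀ (κ : ZpExtension ℚ 2) (γ : Field.absoluteGaloisGroup ℚ), κ.IsCyclotomic → κ.IsTopGenerator γ →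
      ∀ z : MultIrredClass.c311542bt1.selmerInftyPreimage κ n, 2 • z = 0 →
        (⇑(MultIrredClass.c311542bt1.conjH1 2 (κ.layerSubgroup n) γ - AddMonoidHom.id (MultIrredClass.c311542bt1.subgroupH1 2 (κ.layerSubgroup n))))^[b] (z : MultIrredClass.c311542bt1.subgroupH1 2 (κ.layerSubgroup n)) = 0) (hsha : MissingLowerBoundAt MultIrredClass.c311542bt1 2) : BSDp MultIrredClass.c311542bt1 2 :=
  bsdp_of_missingPPartAt _ 2 hGZK (hr.le.trans zero_le_one) (missingPPartAt_of_lower_of_upper _ 2 hsha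
    (MultKatoRat.missingUpperBoundAt_two_nonsplit_of_towerGapMember_of_descent hne h12 hdesc h15 h41ns' h41sp hmod hGZK hCassels
      hC _ hr MultIrredClass.mult_two_311542bt1 _ (IsIsogenous.refl_holds _) MultIrredClass.nonsplit_two_311542bt1
      (towerGapAtTwo_311542bt1_RX hb hkill) (Or.inl MultIrredClass.irr_two_311542bt1)))

/-! ### `311542r1` (class `311542r`, `N = 311542`, NON-SPLIT at `2`; kernel data: `MultIrredClass.c311542r1` of `ByReductionTypeAtTwoMultIrredClass311542r`)
CERTIFICATE OF RECORD (REL-χ TOP, tower/NOTE-RELCHI-GEN17.md §4; kit j296470, ENGINE `tower/gen17/engine/sel2relchi.gp` @b474f5a19f1a2c12, layer 3): upper induced basis `ehi₃ = 10` (σ-vector `3,4,5,6,7,8,9,10`, `dim S^hi[ν^7] = 9`), symbol functionals `ncert = 14` (places ['11w1', '17w1', '17w2', '17w3', '17w4', '2', '7w1', '7w2']), ranks `r(S^hi) = 8`, `r(S^hi[ν^7]) = 7` ⇒ `r − r_H = 1 = dim S^hi − dim S^hi[ν^7]` ⇒ `(σ'−1)^15` kills `A_4[2]` (`n = 4`,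 `b = 15`). Plain bound `a_4 ≤ 2·ehi₃ − r = 12`. ONE engine so far (RC-182: second engine wanted). -/

/-- **Tower gap for `311542r1` from the EXPONENT certificate** «`(conj_γ − id)^[b]` kills `A_n[2]`, `b < 2ⁿ`» (numeral-free; of record `n = 4`, `b = 15`, REL-χ TOP at layer 3 —
an INFERRED exponent, no layer-4 descent was run). [cite: GreenbergLNM1716, §1 p. 60 and §3 pp. 85–86] [cite: Washington1997, §13.2] -/
theorem towerGapAtTwo_311542r1_RX
    {n b : ℕ} (hb : b < 2 ^ n)
    (hkill : ∀ (κ : ZpExtension ℚ 2) (γ : Field.absoluteGaloisGroup ℚ), κ.IsCyclotomic → κ.IsTopGenerator γ →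
      ∀ z : MultIrredClass.c311542r1.selmerInftyPreimage κ n, 2 • z = 0 →
        (⇑(MultIrredClass.c311542r1.conjH1 2 (κ.layerSubgroup n) γ - AddMonoidHom.id (MultIrredClass.c311542r1.subgroupH1 2 (κ.layerSubgroup n))))^[b] (z : MultIrredClass.c311542r1.subgroupH1 2 (κ.layerSubgroup n)) = 0) : TowerGapAtTwo MultIrredClass.c311542r1 :=
  TowerRelChi.towerGapAtTwo_of_exponent_classes_of_irr MultIrredClass.c311542r1 MultIrredClass.irr_two_311542r1 hb hkill

/-- **UPPER HALF `MissingUpperBoundAt 311542r1 2`** (item 19922 AT this curve; Cassels ⇒ its class) from the EXPONENT certificate: PRINT {h41ns', h41sp, hmod, hGZK, hCassels, hC}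
+ MEMO {hKato (RC-2), hGS (RC-4)} + CERT {hr, hb, hkill}. [cite: GreenbergLNM1716, §3 pp. 85–94 and §4 pp. 112–113] [cite: Cesnavicius2018, Thm. 1.2] [cite: Miller2011LMS, Def. 1.1] -/
theorem missingUpperBoundAt_two_311542r1_RX
    (hKato : ∀ (W : WeierstrassCurve ℚ) [W.IsElliptic] [W.IsGloballyMinimal],
      ¬ W.HasCM → Mult W 2 → O1.KatoMultiplicativeDivisibilityRat W 2)
    (h41ns' : thm41Analogue_charValue_rankZero_numberField_anyPrime_oddLocalDegree)
    (h41sp : thm41Analogue_charValue_rankZero_split_baseChange_anyPrime)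
    (hmod : nonempty_modularParametrizationData) (hGZK : rank_eq_analyticRank_of_analyticRank_le_one)
    (hCassels : bsdRHS_eq_of_isIsogenous) (hC : cesnavicius_not_two_dvd_maninConstant_of_two_dvd_level)
    (hGS : ∀ (W : WeierstrassCurve ℚ) [W.IsElliptic] [W.IsGloballyMinimal],
      W.HasSplitMultiplicativeReductionAtPrime 2 → greenberg_stevens (W := W) (p := 2))
    (hr : MultIrredClass.c311542r1.analyticRank = 0)
    {n b : ℕ} (hb : b < 2 ^ n)
    (hkill : ∀ (κ : ZpExtension ℚ 2) (γ : Field.absoluteGaloisGroup ℚ), κ.IsCyclotomic → κ.IsTopGenerator γ →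
      ∀ z : MultIrredClass.c311542r1.selmerInftyPreimage κ n, 2 • z = 0 →
        (⇑(MultIrredClass.c311542r1.conjH1 2 (κ.layerSubgroup n) γ - AddMonoidHom.id (MultIrredClass.c311542r1.subgroupH1 2 (κ.layerSubgroup n))))^[b] (z : MultIrredClass.c311542r1.subgroupH1 2 (κ.layerSubgroup n)) = 0) : MissingUpperBoundAt MultIrredClass.c311542r1 2 :=
  TowerRelChi.missingUpperBoundAt_two_of_exponent_classes MultIrredClass.c311542r1 hKato h41ns' h41sp hmod hGZK hCassels hC hGS hr
    MultIrredClass.mult_two_311542r1 MultIrredClass.irr_two_311542r1 hb hkill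

/-- **DESK DISPLAY `BSD(311542r1, 2)`, BORN DESCENT-KEYED** (NON-SPLIT at `2`): located inputs {`hne`, `h12`, `hdesc`, `h15`},
gap = `towerGapAtTwo_311542r1_RX`; display = PRINT {h41ns', h41sp, hmod, hGZK, hCassels, hC} + `hdesc` + `hr` + CERT {hb, hkill} + `hsha`.
Not a booking. [cite: Kato2004Asterisque, Thm. 17.4] [cite: Miller2011LMS, Def. 1.1] -/
theorem bsdp_two_311542r1_RX_of_descent
    (hne : Kato2004.nonempty_iwasawaH1Data) (h12 : Kato2004.thm12_4)
    (hdesc : Kato2004.exists_multDivisibilityInputsDescent_nonsplit)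
    (h15 : thm15_isTorsion_multiplicative_rat)
    (h41ns' : thm41Analogue_charValue_rankZero_numberField_anyPrime_oddLocalDegree)
    (h41sp : thm41Analogue_charValue_rankZero_split_baseChange_anyPrime)
    (hmod : nonempty_modularParametrizationData) (hGZK : rank_eq_analyticRank_of_analyticRank_le_one)
    (hCassels : bsdRHS_eq_of_isIsogenous) (hC : cesnavicius_not_two_dvd_maninConstant_of_two_dvd_level)
    (hr : MultIrredClass.c311542r1.analyticRank = 0)
    {n b : ℕ} (hb : b < 2 ^ n)
    (hkill : ∀ (κ : ZpExtension ℚ 2) (γ : Field.absoluteGaloisGroup ℚ), κ.IsCyclotomic → κ.IsTopGenerator γ →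
      ∀ z : MultIrredClass.c311542r1.selmerInftyPreimage κ n, 2 • z = 0 →
        (⇑(MultIrredClass.c311542r1.conjH1 2 (κ.layerSubgroup n) γ - AddMonoidHom.id (MultIrredClass.c311542r1.subgroupH1 2 (κ.layerSubgroup n))))^[b] (z : MultIrredClass.c311542r1.subgroupH1 2 (κ.layerSubgroup n)) = 0) (hsha : MissingLowerBoundAt MultIrredClass.c311542r1 2) : BSDp MultIrredClass.c311542r1 2 :=
  bsdp_of_missingPPartAt _ 2 hGZK (hr.le.trans zero_le_one) (missingPPartAt_of_lower_of_upper _ 2 hsha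
    (MultKatoRat.missingUpperBoundAt_two_nonsplit_of_towerGapMember_of_descent hne h12 hdesc h15 h41ns' h41sp hmod hGZK hCassels
      hC _ hr MultIrredClass.mult_two_311542r1 _ (IsIsogenous.refl_holds _) MultIrredClass.nonsplit_two_311542r1
      (towerGapAtTwo_311542r1_RX hb hkill) (Or.inl MultIrredClass.irr_two_311542r1)))

/-! ### `317322p1` (class `317322p`, `N = 317322`, NON-SPLIT at `2`; kernel data: `MultIrredClass.c317322p1` of `ByReductionTypeAtTwoMultIrredClass317322p`)
CERTIFICATE OF RECORD (REL-χ TOP, tower/NOTE-RELCHI-GEN17.md §4; kit j296470, ENGINE `tower/gen17/engine/sel2relchi.gp` @b474f5a19f1a2c12, layer 3): upper induced basis `ehi₃ = 11` (σ-vector `3,5,6,7,8,9,10,11`, `dim S^hi[ν^7] = 10`), symbol functionals `ncert = 17` (places ['17w1', '17w2', '17w3', '17w4', '2', '3w1', '61w1']), ranks `r(S^hi) = 11`, `r(S^hi[ν^7]) = 10` ⇒ `r − r_H = 1 = dim S^hi − dim S^hi[ν^7]` ⇒ `(σ'−1)^15` kills `A_4[2]` (`n = 4`, `b = 15`); moreover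 `r = ehi₃` (K = 0): `cor A_4[2] = 0`, `a_4 = a_3 = 11`. Plain bound `a_4 ≤ 2·ehi₃ − r = 11`. ONE engine so far (RC-182: second engine wanted). -/

/-- **Tower gap for `317322p1` from the EXPONENT certificate** «`(conj_γ − id)^[b]` kills `A_n[2]`, `b < 2ⁿ`» (numeral-free; of record `n = 4`, `b = 15`, REL-χ TOP at layer 3 —
an INFERRED exponent, no layer-4 descent was run). [cite: GreenbergLNM1716, §1 p. 60 and §3 pp. 85–86] [cite: Washington1997, §13.2] -/
theorem towerGapAtTwo_317322p1_RX
    {n b : ℕ} (hb : b < 2 ^ n)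
    (hkill : ∀ (κ : ZpExtension ℚ 2) (γ : Field.absoluteGaloisGroup ℚ), κ.IsCyclotomic → κ.IsTopGenerator γ →
      ∀ z : MultIrredClass.c317322p1.selmerInftyPreimage κ n, 2 • z = 0 →
        (⇑(MultIrredClass.c317322p1.conjH1 2 (κ.layerSubgroup n) γ - AddMonoidHom.id (MultIrredClass.c317322p1.subgroupH1 2 (κ.layerSubgroup n))))^[b] (z : MultIrredClass.c317322p1.subgroupH1 2 (κ.layerSubgroup n)) = 0) : TowerGapAtTwo MultIrredClass.c317322p1 :=
  TowerRelChi.towerGapAtTwo_of_exponent_classes_of_irr MultIrredClass.c317322p1 MultIrredClass.irr_two_317322p1 hb hkill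

/-- **UPPER HALF `MissingUpperBoundAt 317322p1 2`** (item 19922 AT this curve; Cassels ⇒ its class) from the EXPONENT certificate: PRINT {h41ns', h41sp, hmod, hGZK, hCassels, hC}
+ MEMO {hKato (RC-2), hGS (RC-4)} + CERT {hr, hb, hkill}. [cite: GreenbergLNM1716, §3 pp. 85–94 and §4 pp. 112–113] [cite: Cesnavicius2018, Thm. 1.2] [cite: Miller2011LMS, Def. 1.1] -/
theorem missingUpperBoundAt_two_317322p1_RX
    (hKato : ∀ (W : WeierstrassCurve ℚ) [W.IsElliptic] [W.IsGloballyMinimal],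
      ¬ W.HasCM → Mult W 2 → O1.KatoMultiplicativeDivisibilityRat W 2)
    (h41ns' : thm41Analogue_charValue_rankZero_numberField_anyPrime_oddLocalDegree)
    (h41sp : thm41Analogue_charValue_rankZero_split_baseChange_anyPrime)
    (hmod : nonempty_modularParametrizationData) (hGZK : rank_eq_analyticRank_of_analyticRank_le_one)
    (hCassels : bsdRHS_eq_of_isIsogenous) (hC : cesnavicius_not_two_dvd_maninConstant_of_two_dvd_level)
    (hGS : ∀ (W : WeierstrassCurve ℚ) [W.IsElliptic] [W.IsGloballyMinimal],
      W.HasSplitMultiplicativeReductionAtPrime 2 → greenberg_stevens (W := W) (p := 2))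
    (hr : MultIrredClass.c317322p1.analyticRank = 0)
    {n b : ℕ} (hb : b < 2 ^ n)
    (hkill : ∀ (κ : ZpExtension ℚ 2) (γ : Field.absoluteGaloisGroup ℚ), κ.IsCyclotomic → κ.IsTopGenerator γ →
      ∀ z : MultIrredClass.c317322p1.selmerInftyPreimage κ n, 2 • z = 0 →
        (⇑(MultIrredClass.c317322p1.conjH1 2 (κ.layerSubgroup n) γ - AddMonoidHom.id (MultIrredClass.c317322p1.subgroupH1 2 (κ.layerSubgroup n))))^[b] (z : MultIrredClass.c317322p1.subgroupH1 2 (κ.layerSubgroup n)) = 0) : MissingUpperBoundAt MultIrredClass.c317322p1 2 :=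
  TowerRelChi.missingUpperBoundAt_two_of_exponent_classes MultIrredClass.c317322p1 hKato h41ns' h41sp hmod hGZK hCassels hC hGS hr
    MultIrredClass.mult_two_317322p1 MultIrredClass.irr_two_317322p1 hb hkill

/-- **DESK DISPLAY `BSD(317322p1, 2)`, BORN DESCENT-KEYED** (NON-SPLIT at `2`): located inputs {`hne`, `h12`, `hdesc`, `h15`},
gap = `towerGapAtTwo_317322p1_RX`; display = PRINT {h41ns', h41sp, hmod, hGZK, hCassels, hC} + `hdesc` + `hr` + CERT {hb, hkill} + `hsha`.
Not a booking. [cite: Kato2004Asterisque, Thm. 17.4] [cite: Miller2011LMS, Def. 1.1] -/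
theorem bsdp_two_317322p1_RX_of_descent
    (hne : Kato2004.nonempty_iwasawaH1Data) (h12 : Kato2004.thm12_4)
    (hdesc : Kato2004.exists_multDivisibilityInputsDescent_nonsplit)
    (h15 : thm15_isTorsion_multiplicative_rat)
    (h41ns' : thm41Analogue_charValue_rankZero_numberField_anyPrime_oddLocalDegree)
    (h41sp : thm41Analogue_charValue_rankZero_split_baseChange_anyPrime)
    (hmod : nonempty_modularParametrizationData) (hGZK : rank_eq_analyticRank_of_analyticRank_le_one)
    (hCassels : bsdRHS_eq_of_isIsogenous) (hC : cesnavicius_not_two_dvd_maninConstant_of_two_dvd_level)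
    (hr : MultIrredClass.c317322p1.analyticRank = 0)
    {n b : ℕ} (hb : b < 2 ^ n)
    (hkill : ∀ (κ : ZpExtension ℚ 2) (γ : Field.absoluteGaloisGroup ℚ), κ.IsCyclotomic → κ.IsTopGenerator γ →
      ∀ z : MultIrredClass.c317322p1.selmerInftyPreimage κ n, 2 • z = 0 →
        (⇑(MultIrredClass.c317322p1.conjH1 2 (κ.layerSubgroup n) γ - AddMonoidHom.id (MultIrredClass.c317322p1.subgroupH1 2 (κ.layerSubgroup n))))^[b] (z : MultIrredClass.c317322p1.subgroupH1 2 (κ.layerSubgroup n)) = 0) (hsha : MissingLowerBoundAt MultIrredClass.c317322p1 2) : BSDp MultIrredClass.c317322p1 2 :=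
  bsdp_of_missingPPartAt _ 2 hGZK (hr.le.trans zero_le_one) (missingPPartAt_of_lower_of_upper _ 2 hsha
    (MultKatoRat.missingUpperBoundAt_two_nonsplit_of_towerGapMember_of_descent hne h12 hdesc h15 h41ns' h41sp hmod hGZK hCassels
      hC _ hr MultIrredClass.mult_two_317322p1 _ (IsIsogenous.refl_holds _) MultIrredClass.nonsplit_two_317322p1
      (towerGapAtTwo_317322p1_RX hb hkill) (Or.inl MultIrredClass.irr_two_317322p1)))

/-! ### `334050bm1` (class `334050bm`, `N = 334050`, NON-SPLIT at `2`; kernel data: `MultIrredClass.c334050bm1` of `ByReductionTypeAtTwoMultIrredClass334050bm`)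
CERTIFICATE OF RECORD (REL-χ TOP, tower/NOTE-RELCHI-GEN17.md §4; kit j296470, ENGINE `tower/gen17/engine/sel2relchi.gp` @b474f5a19f1a2c12, layer 3): upper induced basis `ehi₃ = 10` (σ-vector `3,4,5,6,7,8,9,10`, `dim S^hi[ν^7] = 9`), symbol functionals `ncert = 15` (places ['131w1', '17w1', '17w2', '17w3', '17w4', '2', '3w1', '5w1']), ranks `r(S^hi) = 3`, `r(S^hi[ν^7]) = 2` ⇒ `r − r_H = 1 = dim S^hi − dim S^hi[ν^7]` ⇒ `(σ'−1)^15` kills `A_4[2]` (`n = 4`, `b = 15`). Plain bound `a_4 ≤ 2·ehi₃ − r = 17`. ONE engine so far (RC-182: second engine wanted). -/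

/-- **Tower gap for `334050bm1` from the EXPONENT certificate** «`(conj_γ − id)^[b]` kills `A_n[2]`, `b < 2ⁿ`» (numeral-free; of record `n = 4`, `b = 15`, REL-χ TOP at layer 3 —
an INFERRED exponent, no layer-4 descent was run). [cite: GreenbergLNM1716, §1 p. 60 and §3 pp. 85–86] [cite: Washington1997, §13.2] -/
theorem towerGapAtTwo_334050bm1_RX
    {n b : ℕ} (hb : b < 2 ^ n)
    (hkill : ∀ (κ : ZpExtension ℚ 2) (γ : Field.absoluteGaloisGroup ℚ), κ.IsCyclotomic → κ.IsTopGenerator γ →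
      ∀ z : MultIrredClass.c334050bm1.selmerInftyPreimage κ n, 2 • z = 0 →
        (⇑(MultIrredClass.c334050bm1.conjH1 2 (κ.layerSubgroup n) γ - AddMonoidHom.id (MultIrredClass.c334050bm1.subgroupH1 2 (κ.layerSubgroup n))))^[b] (z : MultIrredClass.c334050bm1.subgroupH1 2 (κ.layerSubgroup n)) = 0) : TowerGapAtTwo MultIrredClass.c334050bm1 :=
  TowerRelChi.towerGapAtTwo_of_exponent_classes_of_irr MultIrredClass.c334050bm1 MultIrredClass.irr_two_334050bm1 hb hkill

/-- **UPPER HALF `MissingUpperBoundAt 334050bm1 2`** (item 19922 AT this curve; Cassels ⇒ its class) from the EXPONENT certificate: PRINT {h41ns', h41sp, hmod, hGZK, hCassels, hC}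
+ MEMO {hKato (RC-2), hGS (RC-4)} + CERT {hr, hb, hkill}. [cite: GreenbergLNM1716, §3 pp. 85–94 and §4 pp. 112–113] [cite: Cesnavicius2018, Thm. 1.2] [cite: Miller2011LMS, Def. 1.1] -/
theorem missingUpperBoundAt_two_334050bm1_RX
    (hKato : ∀ (W : WeierstrassCurve ℚ) [W.IsElliptic] [W.IsGloballyMinimal],
      ¬ W.HasCM → Mult W 2 → O1.KatoMultiplicativeDivisibilityRat W 2)
    (h41ns' : thm41Analogue_charValue_rankZero_numberField_anyPrime_oddLocalDegree)
    (h41sp : thm41Analogue_charValue_rankZero_split_baseChange_anyPrime)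
    (hmod : nonempty_modularParametrizationData) (hGZK : rank_eq_analyticRank_of_analyticRank_le_one)
    (hCassels : bsdRHS_eq_of_isIsogenous) (hC : cesnavicius_not_two_dvd_maninConstant_of_two_dvd_level)
    (hGS : ∀ (W : WeierstrassCurve ℚ) [W.IsElliptic] [W.IsGloballyMinimal],
      W.HasSplitMultiplicativeReductionAtPrime 2 → greenberg_stevens (W := W) (p := 2))
    (hr : MultIrredClass.c334050bm1.analyticRank = 0)
    {n b : ℕ} (hb : b < 2 ^ n)
    (hkill : ∀ (κ : ZpExtension ℚ 2) (γ : Field.absoluteGaloisGroup ℚ), κ.IsCyclotomic → κ.IsTopGenerator γ →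
      ∀ z : MultIrredClass.c334050bm1.selmerInftyPreimage κ n, 2 • z = 0 →
        (⇑(MultIrredClass.c334050bm1.conjH1 2 (κ.layerSubgroup n) γ - AddMonoidHom.id (MultIrredClass.c334050bm1.subgroupH1 2 (κ.layerSubgroup n))))^[b] (z : MultIrredClass.c334050bm1.subgroupH1 2 (κ.layerSubgroup n)) = 0) : MissingUpperBoundAt MultIrredClass.c334050bm1 2 :=
  TowerRelChi.missingUpperBoundAt_two_of_exponent_classes MultIrredClass.c334050bm1 hKato h41ns' h41sp hmod hGZK hCassels hC hGS hr
    MultIrredClass.mult_two_334050bm1 MultIrredClass.irr_two_334050bm1 hb hkill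

/-- **DESK DISPLAY `BSD(334050bm1, 2)`, BORN DESCENT-KEYED** (NON-SPLIT at `2`): located inputs {`hne`, `h12`, `hdesc`, `h15`},
gap = `towerGapAtTwo_334050bm1_RX`; display = PRINT {h41ns', h41sp, hmod, hGZK, hCassels, hC} + `hdesc` + `hr` + CERT {hb, hkill} + `hsha`.
Not a booking. [cite: Kato2004Asterisque, Thm. 17.4] [cite: Miller2011LMS, Def. 1.1] -/
theorem bsdp_two_334050bm1_RX_of_descent
    (hne : Kato2004.nonempty_iwasawaH1Data) (h12 : Kato2004.thm12_4)
    (hdesc : Kato2004.exists_multDivisibilityInputsDescent_nonsplit)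
    (h15 : thm15_isTorsion_multiplicative_rat)
    (h41ns' : thm41Analogue_charValue_rankZero_numberField_anyPrime_oddLocalDegree)
    (h41sp : thm41Analogue_charValue_rankZero_split_baseChange_anyPrime)
    (hmod : nonempty_modularParametrizationData) (hGZK : rank_eq_analyticRank_of_analyticRank_le_one)
    (hCassels : bsdRHS_eq_of_isIsogenous) (hC : cesnavicius_not_two_dvd_maninConstant_of_two_dvd_level)
    (hr : MultIrredClass.c334050bm1.analyticRank = 0)
    {n b : ℕ} (hb : b < 2 ^ n)
    (hkill : ∀ (κ : ZpExtension ℚ 2) (γ : Field.absoluteGaloisGroup ℚ), κ.IsCyclotomic → κ.IsTopGenerator γ →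
      ∀ z : MultIrredClass.c334050bm1.selmerInftyPreimage κ n, 2 • z = 0 →
        (⇑(MultIrredClass.c334050bm1.conjH1 2 (κ.layerSubgroup n) γ - AddMonoidHom.id (MultIrredClass.c334050bm1.subgroupH1 2 (κ.layerSubgroup n))))^[b] (z : MultIrredClass.c334050bm1.subgroupH1 2 (κ.layerSubgroup n)) = 0) (hsha : MissingLowerBoundAt MultIrredClass.c334050bm1 2) : BSDp MultIrredClass.c334050bm1 2 :=
  bsdp_of_missingPPartAt _ 2 hGZK (hr.le.trans zero_le_one) (missingPPartAt_of_lower_of_upper _ 2 hsha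
    (MultKatoRat.missingUpperBoundAt_two_nonsplit_of_towerGapMember_of_descent hne h12 hdesc h15 h41ns' h41sp hmod hGZK hCassels
      hC _ hr MultIrredClass.mult_two_334050bm1 _ (IsIsogenous.refl_holds _) MultIrredClass.nonsplit_two_334050bm1
      (towerGapAtTwo_334050bm1_RX hb hkill) (Or.inl MultIrredClass.irr_two_334050bm1)))

/-! ### `368186bc1` (class `368186bc`, `N = 368186`, NON-SPLIT at `2`; kernel data: `MultIrredClass.c368186bc1` of `ByReductionTypeAtTwoMultIrredClass368186bc`)
CERTIFICATE OF RECORD (REL-χ TOP, tower/NOTE-RELCHI-GEN17.md §4; kit j296470, ENGINE `tower/gen17/engine/sel2relchi.gp` @b474f5a19f1a2c12, layer 3): upper induced basis `ehi₃ = 11` (σ-vector `3,5,6,7,8,9,10,11`, `dim S^hi[ν^7] = 10`), symbol functionals `ncert = 16` (places ['13w1', '17w1', '17w2', '17w3', '17w4', '2', '7w1', '7w2']), ranks `r(S^hi) = 11`, `r(S^hi[ν^7]) = 10` ⇒ `r − r_H = 1 = dim S^hi − dim S^hi[ν^7]` ⇒ `(σ'−1)^15` kills `A_4[2]` (`n =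 4`, `b = 15`); moreover `r = ehi₃` (K = 0): `cor A_4[2] = 0`, `a_4 = a_3 = 11`. Plain bound `a_4 ≤ 2·ehi₃ − r = 11`. ONE engine so far (RC-182: second engine wanted). -/

/-- **Tower gap for `368186bc1` from the EXPONENT certificate** «`(conj_γ − id)^[b]` kills `A_n[2]`, `b < 2ⁿ`» (numeral-free; of record `n = 4`, `b = 15`, REL-χ TOP at layer 3 —
an INFERRED exponent, no layer-4 descent was run). [cite: GreenbergLNM1716, §1 p. 60 and §3 pp. 85–86] [cite: Washington1997, §13.2] -/
theorem towerGapAtTwo_368186bc1_RX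
    {n b : ℕ} (hb : b < 2 ^ n)
    (hkill : ∀ (κ : ZpExtension ℚ 2) (γ : Field.absoluteGaloisGroup ℚ), κ.IsCyclotomic → κ.IsTopGenerator γ →
      ∀ z : MultIrredClass.c368186bc1.selmerInftyPreimage κ n, 2 • z = 0 →
        (⇑(MultIrredClass.c368186bc1.conjH1 2 (κ.layerSubgroup n) γ - AddMonoidHom.id (MultIrredClass.c368186bc1.subgroupH1 2 (κ.layerSubgroup n))))^[b] (z : MultIrredClass.c368186bc1.subgroupH1 2 (κ.layerSubgroup n)) = 0) : TowerGapAtTwo MultIrredClass.c368186bc1 :=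
  TowerRelChi.towerGapAtTwo_of_exponent_classes_of_irr MultIrredClass.c368186bc1 MultIrredClass.irr_two_368186bc1 hb hkill

/-- **UPPER HALF `MissingUpperBoundAt 368186bc1 2`** (item 19922 AT this curve; Cassels ⇒ its class) from the EXPONENT certificate: PRINT {h41ns', h41sp, hmod, hGZK, hCassels, hC}
+ MEMO {hKato (RC-2), hGS (RC-4)} + CERT {hr, hb, hkill}. [cite: GreenbergLNM1716, §3 pp. 85–94 and §4 pp. 112–113] [cite: Cesnavicius2018, Thm. 1.2] [cite: Miller2011LMS, Def. 1.1] -/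
theorem missingUpperBoundAt_two_368186bc1_RX
    (hKato : ∀ (W : WeierstrassCurve ℚ) [W.IsElliptic] [W.IsGloballyMinimal],
      ¬ W.HasCM → Mult W 2 → O1.KatoMultiplicativeDivisibilityRat W 2)
    (h41ns' : thm41Analogue_charValue_rankZero_numberField_anyPrime_oddLocalDegree)
    (h41sp : thm41Analogue_charValue_rankZero_split_baseChange_anyPrime)
    (hmod : nonempty_modularParametrizationData) (hGZK : rank_eq_analyticRank_of_analyticRank_le_one)
    (hCassels : bsdRHS_eq_of_isIsogenous) (hC : cesnavicius_not_two_dvd_maninConstant_of_two_dvd_level)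
    (hGS : ∀ (W : WeierstrassCurve ℚ) [W.IsElliptic] [W.IsGloballyMinimal],
      W.HasSplitMultiplicativeReductionAtPrime 2 → greenberg_stevens (W := W) (p := 2))
    (hr : MultIrredClass.c368186bc1.analyticRank = 0)
    {n b : ℕ} (hb : b < 2 ^ n)
    (hkill : ∀ (κ : ZpExtension ℚ 2) (γ : Field.absoluteGaloisGroup ℚ), κ.IsCyclotomic → κ.IsTopGenerator γ →
      ∀ z : MultIrredClass.c368186bc1.selmerInftyPreimage κ n, 2 • z = 0 →
        (⇑(MultIrredClass.c368186bc1.conjH1 2 (κ.layerSubgroup n) γ - AddMonoidHom.id (MultIrredClass.c368186bc1.subgroupH1 2 (κ.layerSubgroup n))))^[b] (z : MultIrredClass.c368186bc1.subgroupH1 2 (κ.layerSubgroup n)) = 0) : MissingUpperBoundAt MultIrredClass.c368186bc1 2 :=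
  TowerRelChi.missingUpperBoundAt_two_of_exponent_classes MultIrredClass.c368186bc1 hKato h41ns' h41sp hmod hGZK hCassels hC hGS hr
    MultIrredClass.mult_two_368186bc1 MultIrredClass.irr_two_368186bc1 hb hkill

/-- **DESK DISPLAY `BSD(368186bc1, 2)`, BORN DESCENT-KEYED** (NON-SPLIT at `2`): located inputs {`hne`, `h12`, `hdesc`, `h15`},
gap = `towerGapAtTwo_368186bc1_RX`; display = PRINT {h41ns', h41sp, hmod, hGZK, hCassels, hC} + `hdesc` + `hr` + CERT {hb, hkill} + `hsha`.
Not a booking. [cite: Kato2004Asterisque, Thm. 17.4] [cite: Miller2011LMS, Def. 1.1] -/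
theorem bsdp_two_368186bc1_RX_of_descent
    (hne : Kato2004.nonempty_iwasawaH1Data) (h12 : Kato2004.thm12_4)
    (hdesc : Kato2004.exists_multDivisibilityInputsDescent_nonsplit)
    (h15 : thm15_isTorsion_multiplicative_rat)
    (h41ns' : thm41Analogue_charValue_rankZero_numberField_anyPrime_oddLocalDegree)
    (h41sp : thm41Analogue_charValue_rankZero_split_baseChange_anyPrime)
    (hmod : nonempty_modularParametrizationData) (hGZK : rank_eq_analyticRank_of_analyticRank_le_one)
    (hCassels : bsdRHS_eq_of_isIsogenous) (hC : cesnavicius_not_two_dvd_maninConstant_of_two_dvd_level)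
    (hr : MultIrredClass.c368186bc1.analyticRank = 0)
    {n b : ℕ} (hb : b < 2 ^ n)
    (hkill : ∀ (κ : ZpExtension ℚ 2) (γ : Field.absoluteGaloisGroup ℚ), κ.IsCyclotomic → κ.IsTopGenerator γ →
      ∀ z : MultIrredClass.c368186bc1.selmerInftyPreimage κ n, 2 • z = 0 →
        (⇑(MultIrredClass.c368186bc1.conjH1 2 (κ.layerSubgroup n) γ - AddMonoidHom.id (MultIrredClass.c368186bc1.subgroupH1 2 (κ.layerSubgroup n))))^[b] (z : MultIrredClass.c368186bc1.subgroupH1 2 (κ.layerSubgroup n)) = 0) (hsha : MissingLowerBoundAt MultIrredClass.c368186bc1 2) : BSDp MultIrredClass.c368186bc1 2 :=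
  bsdp_of_missingPPartAt _ 2 hGZK (hr.le.trans zero_le_one) (missingPPartAt_of_lower_of_upper _ 2 hsha
    (MultKatoRat.missingUpperBoundAt_two_nonsplit_of_towerGapMember_of_descent hne h12 hdesc h15 h41ns' h41sp hmod hGZK hCassels
      hC _ hr MultIrredClass.mult_two_368186bc1 _ (IsIsogenous.refl_holds _) MultIrredClass.nonsplit_two_368186bc1
      (towerGapAtTwo_368186bc1_RX hb hkill) (Or.inl MultIrredClass.irr_two_368186bc1)))

/-! ### `381938m1` (class `381938m`, `N = 381938`, NON-SPLIT at `2`; kernel data: `MultIrredClass.c381938m1` of `ByReductionTypeAtTwoMultIrredClass381938m`)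
CERTIFICATE OF RECORD (REL-χ TOP, tower/NOTE-RELCHI-GEN17.md §4; kit j296470, ENGINE `tower/gen17/engine/sel2relchi.gp` @b474f5a19f1a2c12, layer 3): upper induced basis `ehi₃ = 12` (σ-vector `3,5,7,8,9,10,11,12`, `dim S^hi[ν^7] = 11`), symbol functionals `ncert = 35` (places ['17w1', '17w2', '17w3', '17w4', '19w1', '2', '23w1', '23w2', '79w1', '79w2', '79w3', '79w4', '7w1', '7w2']), ranks `r(S^hi) = 4`, `r(S^hi[ν^7]) = 3` ⇒ `r − r_H = 1 = dim S^hi − dim S^hi[ν^7]` ⇒ `(σ'−1)^15` kills `A_4[2]` (`n = 4`, `b = 15`). Plain bound `a_4 ≤ 2·ehi₃ − r = 20`. ONE engine so far (RC-182: second engine wanted). -/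

/-- **Tower gap for `381938m1` from the EXPONENT certificate** «`(conj_γ − id)^[b]` kills `A_n[2]`, `b < 2ⁿ`» (numeral-free; of record `n = 4`, `b = 15`, REL-χ TOP at layer 3 —
an INFERRED exponent, no layer-4 descent was run). [cite: GreenbergLNM1716, §1 p. 60 and §3 pp. 85–86] [cite: Washington1997, §13.2] -/
theorem towerGapAtTwo_381938m1_RX
    {n b : ℕ} (hb : b < 2 ^ n)
    (hkill : ∀ (κ : ZpExtension ℚ 2) (γ : Field.absoluteGaloisGroup ℚ), κ.IsCyclotomic → κ.IsTopGenerator γ →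
      ∀ z : MultIrredClass.c381938m1.selmerInftyPreimage κ n, 2 • z = 0 →
        (⇑(MultIrredClass.c381938m1.conjH1 2 (κ.layerSubgroup n) γ - AddMonoidHom.id (MultIrredClass.c381938m1.subgroupH1 2 (κ.layerSubgroup n))))^[b] (z : MultIrredClass.c381938m1.subgroupH1 2 (κ.layerSubgroup n)) = 0) : TowerGapAtTwo MultIrredClass.c381938m1 :=
  TowerRelChi.towerGapAtTwo_of_exponent_classes_of_irr MultIrredClass.c381938m1 MultIrredClass.irr_two_381938m1 hb hkill

/-- **UPPER HALF `MissingUpperBoundAt 381938m1 2`** (item 19922 AT this curve; Cassels ⇒ its class) from the EXPONENT certificate: PRINT {h41ns', h41sp, hmod, hGZK, hCassels, hC}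
+ MEMO {hKato (RC-2), hGS (RC-4)} + CERT {hr, hb, hkill}. [cite: GreenbergLNM1716, §3 pp. 85–94 and §4 pp. 112–113] [cite: Cesnavicius2018, Thm. 1.2] [cite: Miller2011LMS, Def. 1.1] -/
theorem missingUpperBoundAt_two_381938m1_RX
    (hKato : ∀ (W : WeierstrassCurve ℚ) [W.IsElliptic] [W.IsGloballyMinimal],
      ¬ W.HasCM → Mult W 2 → O1.KatoMultiplicativeDivisibilityRat W 2)
    (h41ns' : thm41Analogue_charValue_rankZero_numberField_anyPrime_oddLocalDegree)
    (h41sp : thm41Analogue_charValue_rankZero_split_baseChange_anyPrime)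
    (hmod : nonempty_modularParametrizationData) (hGZK : rank_eq_analyticRank_of_analyticRank_le_one)
    (hCassels : bsdRHS_eq_of_isIsogenous) (hC : cesnavicius_not_two_dvd_maninConstant_of_two_dvd_level)
    (hGS : ∀ (W : WeierstrassCurve ℚ) [W.IsElliptic] [W.IsGloballyMinimal],
      W.HasSplitMultiplicativeReductionAtPrime 2 → greenberg_stevens (W := W) (p := 2))
    (hr : MultIrredClass.c381938m1.analyticRank = 0)
    {n b : ℕ} (hb : b < 2 ^ n)
    (hkill : ∀ (κ : ZpExtension ℚ 2) (γ : Field.absoluteGaloisGroup ℚ), κ.IsCyclotomic → κ.IsTopGenerator γ →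
      ∀ z : MultIrredClass.c381938m1.selmerInftyPreimage κ n, 2 • z = 0 →
        (⇑(MultIrredClass.c381938m1.conjH1 2 (κ.layerSubgroup n) γ - AddMonoidHom.id (MultIrredClass.c381938m1.subgroupH1 2 (κ.layerSubgroup n))))^[b] (z : MultIrredClass.c381938m1.subgroupH1 2 (κ.layerSubgroup n)) = 0) : MissingUpperBoundAt MultIrredClass.c381938m1 2 :=
  TowerRelChi.missingUpperBoundAt_two_of_exponent_classes MultIrredClass.c381938m1 hKato h41ns' h41sp hmod hGZK hCassels hC hGS hr
    MultIrredClass.mult_two_381938m1 MultIrredClass.irr_two_381938m1 hb hkill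

/-- **DESK DISPLAY `BSD(381938m1, 2)`, BORN DESCENT-KEYED** (NON-SPLIT at `2`): located inputs {`hne`, `h12`, `hdesc`, `h15`},
gap = `towerGapAtTwo_381938m1_RX`; display = PRINT {h41ns', h41sp, hmod, hGZK, hCassels, hC} + `hdesc` + `hr` + CERT {hb, hkill} + `hsha`.
Not a booking. [cite: Kato2004Asterisque, Thm. 17.4] [cite: Miller2011LMS, Def. 1.1] -/
theorem bsdp_two_381938m1_RX_of_descent
    (hne : Kato2004.nonempty_iwasawaH1Data) (h12 : Kato2004.thm12_4)
    (hdesc : Kato2004.exists_multDivisibilityInputsDescent_nonsplit)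
    (h15 : thm15_isTorsion_multiplicative_rat)
    (h41ns' : thm41Analogue_charValue_rankZero_numberField_anyPrime_oddLocalDegree)
    (h41sp : thm41Analogue_charValue_rankZero_split_baseChange_anyPrime)
    (hmod : nonempty_modularParametrizationData) (hGZK : rank_eq_analyticRank_of_analyticRank_le_one)
    (hCassels : bsdRHS_eq_of_isIsogenous) (hC : cesnavicius_not_two_dvd_maninConstant_of_two_dvd_level)
    (hr : MultIrredClass.c381938m1.analyticRank = 0)
    {n b : ℕ} (hb : b < 2 ^ n)
    (hkill : ∀ (κ : ZpExtension ℚ 2) (γ : Field.absoluteGaloisGroup ℚ), κ.IsCyclotomic → κ.IsTopGenerator γ →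
      ∀ z : MultIrredClass.c381938m1.selmerInftyPreimage κ n, 2 • z = 0 →
        (⇑(MultIrredClass.c381938m1.conjH1 2 (κ.layerSubgroup n) γ - AddMonoidHom.id (MultIrredClass.c381938m1.subgroupH1 2 (κ.layerSubgroup n))))^[b] (z : MultIrredClass.c381938m1.subgroupH1 2 (κ.layerSubgroup n)) = 0) (hsha : MissingLowerBoundAt MultIrredClass.c381938m1 2) : BSDp MultIrredClass.c381938m1 2 :=
  bsdp_of_missingPPartAt _ 2 hGZK (hr.le.trans zero_le_one) (missingPPartAt_of_lower_of_upper _ 2 hsha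
    (MultKatoRat.missingUpperBoundAt_two_nonsplit_of_towerGapMember_of_descent hne h12 hdesc h15 h41ns' h41sp hmod hGZK hCassels
      hC _ hr MultIrredClass.mult_two_381938m1 _ (IsIsogenous.refl_holds _) MultIrredClass.nonsplit_two_381938m1
      (towerGapAtTwo_381938m1_RX hb hkill) (Or.inl MultIrredClass.irr_two_381938m1)))

end Summit.BirchSwinnertonDyer.BirchSwinnertonDyer.Theorems.MultTowerRelChiClass

end
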